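/-
# `Balaban1983to89.B5SupWalkFamG` — Bałaban CMP 95 (1984), Proposition 1.2: the printed S1 route FOR THE G-FAMILY OF RECORD,
# reduced to ONE datum — a `B5SupWalkS1.SupRealisation` per member and cube scale — with every other input of
# `B5SupWalkS1.s1_of_walks` discharged by theorems of the tree

statement-level skeleton of published theorems with citation tags; proofs where landed; nothing here is a claim
about the Yang–Mills mass gap

CITATION HEADER (lean-in-tree rule).  Cell `lit-balaban`, unit `lit-balaban-r02` (reader/typer r02 gen 11 = fold owner of block B5),
HOME `run/shared/lean/pub/lit-balaban/` (SKELETON row B5.Prop1.2, cell only; S1-torus programme `lit-balaban-r02/B5-CLOSURE.md` v1.3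
§3 item 5 / §5 item 2; split r02 ∕ p38 gen 8 ∕ r05 gen 17 of HOME/STATUS.md 2026-08-22T03:18–04:12Z).  B5 = T. Bałaban, *Propagators
and renormalization transformations for lattice gauge theories. I*, Commun. Math. Phys. **95** (1984) 17–40 [`Balaban1984PropagatorsI`],
held as `paper:balaban1984-cmp95-propagators-rt-i` (pp. 35–39 = text layer p0019–p0023).

WHAT IS PRINTED (text layer p0020–p0023, verbatim).  p. 36 [PDF 20] L20–21: «A proof of Proposition 1.2 will be given in several
steps. In the first step we will show that the inequalities (1.115)–(1.117), (1.89) imply the proposition.»; pp. 36–39 the random walk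
(1.118)–(1.131) in the sup/Hölder currency; p. 37 [PDF 21] last line – p. 38 [PDF 22] L2: «For example let us prove the inequality
(1.113) assuming the inequalities (1.115)–(1.117). Let us consider ζ∇G∇*J.»; p. 38 L5: «The factors with G are estimated by using
(1.115).»; p. 39 [PDF 23] L6–8: «The proofs of the other inequalities are exactly the same, but in the estimates of G∇*J we have to take
a representation of G adjoint to (1.123), with the operators K(h) acting on the right.»; p. 39 L1–4 (the choice of `M₀(d)`): «Let us
notice that the constant O(1) under the sum above is an absolute constant depending on d only, hence we can fix M₀ depending on d only,
such that the series is convergent.»  (v1.1, r05 SECOND-READ-B5 pass 22 note 22-(a): v1's lines 15–16 attributed to p. 36 two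
sentences that are NOT printed — «The global inequalities (1.115)–(1.117) together with Proposition 1.1 imply Proposition 1.2. We will
prove only that they imply the inequalities (1.110)–(1.113). … Let us prove the first inequality in (1.111)» was our PARAPHRASE of the
typed step `B5.prop12_of_printed_steps` S1; replaced by the printed sentences; loci of «The factors with G …» (p. 38, not p. 37) and of
the `M₀(d)` sentence (p. 39 L1–4, not L10–13) corrected; declarations byte-identical to v1 p317835.)

WHAT THIS MODULE PROVES (kernel-checked, zero sorry).  For B5's top-level tori of record `famG d L a` (`B5Prop12GLattice.famG`:
member `i` = `latticeSettingP12R (nP i.P) (MP i.P) a i.P.K`, G = Δ_a⁻¹), every `d ≥ 1`, odd `L > 1`, `a > 0`: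
§1 the GEOMETRY FIELDS of `SupRealisation` at the cube cover of record (p38 gen 7's `B5WalkTorusGeom`: centres `ctr M M₀`,
   `card_near_ctr_le`, `rowSum_ctr_le`) for ANY `κ : SupConsts` with `κ.cbar = 4`, `33^d ≤ κ.nu`, `K_d(1/4) ≤ κ.Kbar`
   (`hν_of_consts`, `hrow_of_consts`) — the same evaluation as the L² realisation `κW`;
§2 **`prop12_famG_of_supRealisation`**: `B5.Prop12Printed (famG d L a)` FROM a family
   `real : ∀ i M₀, 1 ≤ M₀ → SupRealisation (famG d L a i) (kdW (nP i.P) (MP i.P)) (gP12R (MP i.P) (nP i.P) a i.P.K) M₀ κ (R i M₀) (V i M₀)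
   (Vg i M₀) (X i M₀) (S i M₀)` ALONE — r02's `B5SupWalkS1.s1_of_walks` with its other five inputs supplied by theorems of the tree:
   the L² realisations `B5WalkRealisationTorus.realisation_famG` (step S1′, (1.114)), the sign conditions
   `B5SettingP12Real.modelSigns_latticeSettingP12R`, (1.115)–(1.117) for the family `B5Prop12GHolds.global115_117_famG_printed`
   (p. 38 «The factors with G are estimated by using (1.115)»), Proposition 1.1 `prop11Printed_famG`, and (1.126)–(1.127)
   `kernel126_127_kdW_fam`.  So the printed S1 route for the family closes the moment the `SupRealisation` of record is inhabited
   (its slot `rep` (direct) = r02's `B5SupRepTorus.repS`; the adjoint `rep`, the Hölder factor estimates (1.125)/(1.129)/(1.130) and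
   the `DomCert`s are p38 gen 8's files B–D, the ℓ¹-(1.128) r05 gen 17's).

HONEST SCOPE.  (1) Plumbing only: no estimate of B5 is proved here; the conclusion `B5.Prop12Printed (famG d L a)` is ALREADY a theorem
of the tree (`B5Prop12GHolds.prop12_famG_printed`, alternative Combes–Thomas route) and (1.115)–(1.117) enter from that theorem, as
p. 38 uses them — the value of the S1 route is the printed mechanism realised end to end, NOT a new head.  (2) The hypothesis `real`
is exactly the datum the programme's remaining files construct; nothing about it is assumed here beyond its type.
-/
import Mathlib
import Literature.MathematicalPhysics.QuantumFieldTheory.Balaban1983to89.B5SupWalkS1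
import Literature.MathematicalPhysics.QuantumFieldTheory.Balaban1983to89.B5WalkRealisationTorus
import Literature.MathematicalPhysics.QuantumFieldTheory.Balaban1983to89.B5Prop12GHolds

open scoped BigOperators Real

namespace Literature.MathematicalPhysics.QuantumFieldTheory.Balaban1983to89.B5SupWalkFamG

open Literature.MathematicalPhysics.QuantumFieldTheory.Balaban1983to89
open Literature.MathematicalPhysics.QuantumFieldTheory.Balaban1983to89.B4Sect5Proof (latticeConst)
open Literature.MathematicalPhysics.QuantumFieldTheory.Balaban1983to89.B5SettingP12Real (latticeSettingP12R gP12R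
  modelSigns_latticeSettingP12R)
open Literature.MathematicalPhysics.QuantumFieldTheory.Balaban1983to89.B5SiteBridgeP12 (nP MP one_le_nP)
open Literature.MathematicalPhysics.QuantumFieldTheory.Balaban1983to89.B5ResidualGpTorusHolds (TopIdx)
open Literature.MathematicalPhysics.QuantumFieldTheory.Balaban1983to89.B5Prop12GLattice (famG)
open Literature.MathematicalPhysics.QuantumFieldTheory.Balaban1983to89.B5Prop12GHolds (global115_117_famG_printed)
open Literature.MathematicalPhysics.QuantumFieldTheory.Balaban1983to89.B5WalkTorusGeom (TorR Cen ctr rowSum_ctr_le card_near_ctr_le)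
open Literature.MathematicalPhysics.QuantumFieldTheory.Balaban1983to89.B5WalkCarrierTorus (Vsp)
open Literature.MathematicalPhysics.QuantumFieldTheory.Balaban1983to89.B5WalkRealisationTorus (kdW κW realisation_famG
  prop11Printed_famG kernel126_127_kdW_fam)
open Literature.MathematicalPhysics.QuantumFieldTheory.Balaban1983to89.B5SupWalk131 (SupConsts)
open Literature.MathematicalPhysics.QuantumFieldTheory.Balaban1983to89.B5SupWalkS1 (SupRealisation s1_of_walks)

noncomputable section

/-! ## §1 The geometry fields of `SupRealisation` at the cube cover of record -/

section Geometry

variable {d : ℕ} (M : Fin d → ℕ) [hM : ∀ μ, NeZero (M μ)] {M₀ : ℕ}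

/-- **the field `SupRealisation.hν` at the cover of record**: at most `κ.nu` cube centres within `κ.cbar·M₀` of any point, for any
`κ` with `κ.cbar = 4` and `33^d ≤ κ.nu` (p38 gen 7's `card_near_ctr_le`: `(8c̄ + 1)^d`). [cite: Balaban1984PropagatorsI, (1.131) p.38,
p.39 («an absolute constant depending on d only»)] -/
theorem hν_of_consts (hM₀ : 1 ≤ M₀) (κ : SupConsts) (hc : κ.cbar = 4) (hν : (33 : ℝ) ^ d ≤ κ.nu) (x : TorR M) :
    ((Finset.univ.filter fun z : Cen M M₀ => dist x (ctr M M₀ z) ≤ κ.cbar * M₀).card : ℝ) ≤ κ.nu := by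
  rw [hc]
  have h := card_near_ctr_le M hM₀ (by norm_num : (0 : ℝ) ≤ 4) x
  have e : ((8 : ℝ) * 4 + 1) ^ d = 33 ^ d := by norm_num
  rw [e] at h
  exact h.trans hν

/-- **the field `SupRealisation.hrow` at the cover of record**: the row sum of (1.131) at rate `(2M₀)⁻¹` over the centres is at most
`κ.Kbar` for any `κ` with `K_d(1/4) ≤ κ.Kbar` (p38 gen 7's `rowSum_ctr_le`). [cite: Balaban1984PropagatorsI, (1.131) p.38] -/
theorem hrow_of_consts (hM₀ : 1 ≤ M₀) (κ : SupConsts) (hK : latticeConst d (1 / 4) ≤ κ.Kbar) (z : Cen M M₀) :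
    ∑ z' : Cen M M₀, Real.exp (-((2 * (M₀ : ℝ))⁻¹ * dist (ctr M M₀ z) (ctr M M₀ z'))) ≤ κ.Kbar :=
  (rowSum_ctr_le M hM₀ z).trans hK

end Geometry

/-! ## §2 Proposition 1.2 for the family of record from a `SupRealisation` family alone -/

section Capstone

variable {d L : ℕ} {a : ℝ}

/-- **PROPOSITION 1.2 FOR THE G-FAMILY OF RECORD BY THE PRINTED S1 ROUTE, FROM THE SUP REALISATIONS ALONE.**  Given, for every member
`i` of `famG d L a` and every cube scale `M₀ ≥ 1`, a `SupRealisation` of the printed sup/Hölder walk (any index type `R` of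
representations, carriers `V`, `Vg`, centre spaces `X`, `S`, one family of uniform constants `κ`), Proposition 1.2 (1.110)–(1.113)
holds for the family: `s1_of_walks` with the L² realisations of record (`realisation_famG`, S1′), `ModelSigns`, (1.115)–(1.117)
(`global115_117_famG_printed`), Proposition 1.1 (`prop11Printed_famG`) and (1.126)–(1.127) (`kernel126_127_kdW_fam`) supplied.
[cite: Balaban1984PropagatorsI, Prop. 1.2 pp.35–36, pp.36–39 (S1), p.39 L1–8] -/
theorem prop12_famG_of_supRealisation (hd : 1 ≤ d) (hL : Odd L ∧ 1 < L) (ha : 0 < a) (κ : SupConsts)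
    {R : TopIdx d L → ℕ → Type} {V Vg : ∀ (i : TopIdx d L) (M₀ : ℕ), R i M₀ → Type}
    [∀ i M₀ r, SeminormedAddCommGroup (V i M₀ r)] [∀ i M₀ r, Module ℝ (V i M₀ r)]
    [∀ i M₀ r, SeminormedAddCommGroup (Vg i M₀ r)] [∀ i M₀ r, Module ℝ (Vg i M₀ r)]
    {X : TopIdx d L → ℕ → Type} [∀ i M₀, PseudoMetricSpace (X i M₀)] {S : TopIdx d L → ℕ → Type} [∀ i M₀, Fintype (S i M₀)]
    (real : ∀ (i : TopIdx d L) (M₀ : ℕ), 1 ≤ M₀ →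
      SupRealisation (famG d L a i) (kdW (nP i.P) (MP i.P)) (gP12R (MP i.P) (nP i.P) a i.P.K) M₀ κ
        (R i M₀) (V i M₀) (Vg i M₀) (X i M₀) (S i M₀)) :
    B5.Prop12Printed (famG d L a) :=
  s1_of_walks (famG d L a) (fun i => gP12R (MP i.P) (nP i.P) a i.P.K) (fun i : TopIdx d L => kdW (nP i.P) (MP i.P)) (κW d a) κ
    (VL := fun i _ => Vsp (nP i.P) (MP i.P)) (XL := fun i _ => TorR (MP i.P)) (SL := fun i M₀ => Cen (MP i.P) M₀)
    (realisation_famG d L ha) real (fun i => modelSigns_latticeSettingP12R (MP i.P) (nP i.P) a i.P.K)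
    (global115_117_famG_printed hd hL ha) (prop11Printed_famG d L ha) (kernel126_127_kdW_fam hd L)

end Capstone

end

end Literature.MathematicalPhysics.QuantumFieldTheory.Balaban1983to89.B5SupWalkFamG
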